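import Summits.Langlands.Langlands.Theorems.SoloInformedGLOneSerreDischarged
import Literature.NumberTheory.PAdicHodge.LabelledWeightsRankOneInertiaShape
import Literature.NumberTheory.Automorphic.GLOneArchParameterOfAlgebraicCharacter
import HarnessLib

/-!
# Solo-informed `GL₁` reciprocity: the Hodge–Tate clause at EVERY place `v ∣ ℓ`, and the
R3⁺-repaired `n = 1` conjunct over every number field — unconditionally

The accepted `SoloInformedGLOneSerreDischarged` reduced the R3⁺-repaired reciprocity conjunct
`R3plus.GlobalLanglandsCorrespondenceGLnR3plus 1 K 𝓡 hcpt` (every number field `K`, every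
reciprocity datum) to **HT₁**: for every algebraic Hecke character `θ` of infinity type `(p, q)`,
every `ι : ℚ̄_ℓ ≃ ℂ` and every `v ∣ ℓ`, Weil's `ℓ`-adic character `r_{θ,ι}` is Hodge–Tate compatible
with `π_θ` at `v` for THE pinned datum, i.e. its `τ`-labelled Hodge–Tate weight at each continuous
`τ : K_v → ℚ̄_ℓ` is the exponent `n_{ι ∘ τ|_K}` of `θ` (`SoloInformedGLOneHodgeTateLocallyParallel`
settled the locally parallel places only).

Here HT₁ is PROVED in general (`hodgeTateCompatibleAt_weilRep`), from the local theorem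
`RankOneLabelledWeights.fontainePst_labelledHodgeTateWeights_of_inertia_eq_mul_prod_emb`
(labelled weights of a rank-one character of inertia shape `g · ∏_e e(Art)^{-n_e}` are `{n_τ}`;
Serre–Tate, by `ℂ_{K_v}`-periods) and Weil's local shape of `r_{θ,ι}` on inertia
(`HasInfinityType.weilRep_toAbsGalois_apply`).  Consequently

* `labelledHodgeTateWeightsAt_weilRep_eq_singleton_all` — `HT_τ(r_{θ,ι}|_{Γ_{K_v}}) = {n_{ι∘τ|_K}}`
  for every `v ∣ ℓ` and every continuous `τ`;
* `hodgeTateCompatibleAt_weilRep` — HT₁;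
* ★ `globalLanglandsCorrespondenceGLnR3plus_one` — the R3⁺-repaired reciprocity conjunct for `n = 1`
  holds over EVERY number field `K`, for every reciprocity datum and every compactness witness,
  with no named fact left as a hypothesis.

## References
* [SerreAbelianLadic1968] J.-P. Serre, *Abelian ℓ-adic representations*, Ch. III §1.1, §2.3, App. A.4–A.5.
* [BuzzardGeeLMS2014] K. Buzzard, T. Gee, *The conjectural connections …*, Conj. 3.2.1–3.2.2, Rem. 3.2.3.
* [Clozel1990] L. Clozel, *Motifs et formes automorphes*, §3.3.
* [Patrikis2019] S. Patrikis, *Variations on a theorem of Tate*, §2.7.1 and Prop. 2.2.1.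
-/

noncomputable section

open scoped MatrixGroups Matrix Classical Polynomial NumberField
open NumberField IsDedekindDomain Field Polynomial Filter
open Literature.NumberTheory.Automorphic Literature.NumberTheory.GaloisRepresentations
open Literature.NumberTheory.PAdicHodge

namespace Summit.Langlands.Langlands.Theorems

namespace GLOneRigidity

section LocalWeights

variable {K : Type} [Field K] [NumberField K] {hcpt : isCompact_glFiniteIntegralLevel 1 K}
  {ℓ : ℕ} [Fact ℓ.Prime] {θ : HeckeCharacter K} {p q : InfinitePlace K → ℤ}
  {T : Finset (HeightOneSpectrum (𝓞 K))} {e : HeightOneSpectrum (𝓞 K) → ℕ}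

/-- **`HT_τ(r_{θ,ι}|_{Γ_{K_v}}) = {n_{ι∘τ|_K}}` at EVERY `v ∣ ℓ` and every continuous label `τ`.**
Weil's `ℓ`-adic character of the algebraic Hecke character `θ` (infinity type `(p,q)`, modulus
`(T,e)`) has, on the inertia of `W_{K_v}`, the shape
`r(w)₀₀ = ι⁻¹(θ(⟨Art w⟩_v)) · ∏_e e(Art w)^{-n_e}` with the first factor trivial on the congruence
units (`weilRep_toAbsGalois_apply`); the local theorem
`fontainePst_labelledHodgeTateWeights_of_inertia_eq_mul_prod_emb` then reads off the labelled
weight `n_{ι∘τ|_K}` at `τ`.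
[cite: SerreAbelianLadic1968, Ch. III §1.1 and App. A.4–A.5] [cite: Patrikis2019, §2.7.1] -/
theorem labelledHodgeTateWeightsAt_weilRep_eq_singleton_all (ι : PadicAlgCl ℓ ≃+* ℂ)
    (hinf : θ.HasInfinityType p q) (hmod : HeckeCharacter.IsModulus θ T e)
    {v : HeightOneSpectrum (𝓞 K)} (hv : ((ℓ : ℕ) : 𝓞 K) ∈ v.asIdeal)
    (τ : v.adicCompletion K →+* PadicAlgCl ℓ) (hτ : Continuous τ) :
    (hinf.weilRep hmod ι).labelledHodgeTateWeightsAt v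
      (fontainePstAdicCompletion v ℓ hv).algebra (fontainePstAdicCompletion v ℓ hv).𝔅 τ =
      {HeckeCharacter.embExponent p q
        ((ι : PadicAlgCl ℓ →+* ℂ).comp (τ.comp (algebraMap K (v.adicCompletion K))))} := by
  haveI := LocalField.charZero_adicCompletion v
  have hF := LocalField.valuation_adicCompletion_natCast_lt_one v ℓ hv
  obtain ⟨ϖ, hϖ⟩ :=
    Valuation.exists_isUniformizer_of_isCyclic_of_nontrivial (ValuativeRel.valuation (v.adicCompletion K))
  rw [FramedGaloisRep.labelledHodgeTateWeightsAt_def]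
  change (letI := (fontainePst (v.adicCompletion K) ℓ hF).algebra;
    (fontainePst (v.adicCompletion K) ℓ hF).𝔅.labelledHodgeTateWeights
      (FramedRep.toContinuousRep ((hinf.weilRep hmod ι).toLocal v)) τ) = _
  have h := RankOneLabelledWeights.fontainePst_labelledHodgeTateWeights_of_inertia_eq_mul_prod_emb hF hϖ
    (Finset.univ : Finset {f : v.adicCompletion K →+* PadicAlgCl ℓ // Continuous f}) (fun f => f.1)
    (fun f => f.2)
    (fun f => -HeckeCharacter.embExponent p q
      ((ι : PadicAlgCl ℓ →+* ℂ).comp (f.1.comp (algebraMap K (v.adicCompletion K)))))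
    ((hinf.weilRep hmod ι).toLocal v)
    (fun w => (ι.symm (θ (localUnits v (canonicalArtin (v.adicCompletion K) w)) : ℂ)))
    (HeckeCharacter.congrUnits v (e v)) (HeckeCharacter.isOpen_congrUnits v (e v))
    (fun w _ hw => by rw [hmod.map_localUnits_eq_one_of_mem_congrUnits hw, Units.val_one, map_one])
    (fun w _ => by
      rw [FramedGaloisRep.toLocal_apply]
      exact hinf.weilRep_toAbsGalois_apply hmod ι (fun w hw => HeckeCharacter.isUnramifiedAt_of_isModulus' hmod hw) hv
        (canonicalArtin (v.adicCompletion K))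
        (isLocalArtinMap_canonicalArtin_holds (v.adicCompletion K)) w)
    τ hτ
  rw [h, Finset.sum_filter,
    Fintype.sum_eq_single (⟨τ, hτ⟩ : {f : v.adicCompletion K →+* PadicAlgCl ℓ // Continuous f})
      (fun f hf => if_neg fun h' => hf (Subtype.ext h')),
    if_pos rfl, neg_neg]

/-- **HT₁ — Weil's `ℓ`-adic character is Hodge–Tate compatible with `π_θ` at EVERY `v ∣ ℓ`**: the
clause `R3plus.HodgeTateCompatibleAt` of the repaired summit (Buzzard–Gee recipe `{-a}`, Clozel's
parameter `a_φ = -n_φ`), for `π` the automorphic representation of `GL₁` with Hecke character `θ`,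
every reciprocity datum, every `ι` and every place above `ℓ`.
[cite: BuzzardGeeLMS2014, Conj. 3.2.2 and Rem. 3.2.3] [cite: Clozel1990, §3.3]
[cite: SerreAbelianLadic1968, Ch. III §1.1 and App. A.5] -/
theorem hodgeTateCompatibleAt_weilRep (𝓡 : ReciprocityData K)
    (ι : PadicAlgCl ℓ ≃+* ℂ) (π : AutomorphicRepData (AutomorphyDatum.gl 1 K hcpt))
    (hχ : ∀ (g : (AdelicGroupData.gl 1 K).Adelic), ∀ φ ∈ π.W,
      rightTranslation (AdelicGroupData.gl 1 K) g φ -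
        ((θ (Matrix.GeneralLinearGroup.det g) : ℂˣ) : ℂ) • φ ∈ π.W')
    (hinf : θ.HasInfinityType p q) (hmod : HeckeCharacter.IsModulus θ T e)
    {v : HeightOneSpectrum (𝓞 K)} (hv : ((ℓ : ℕ) : 𝓞 K) ∈ v.asIdeal) :
    R3plus.HodgeTateCompatibleAt 𝓡 ι π (hinf.weilRep hmod ι) v hv := by
  obtain ⟨T₀, hT₀, hTa⟩ := π.exists_hasInfinityType_of_hasInfinityType_heckeCharacter_glOne hχ hinf
  rw [R3plus.hodgeTateCompatibleAt_iff_of_hasInfinityType hT₀]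
  intro τ hτ
  have hW : (hinf.weilRep hmod ι).labelledHodgeTateWeightsAt v (𝓡.pst ℓ v hv).algebra
      (𝓡.pst ℓ v hv).𝔅 τ =
      {HeckeCharacter.embExponent p q (ι.toRingHom.comp (τ.comp (algebraMap K (v.adicCompletion K))))} :=
    labelledHodgeTateWeightsAt_weilRep_eq_singleton_all ι hinf hmod hv τ hτ
  have hneg : ∀ s : Multiset ArchWeight,
      s.map (fun w : ArchWeight => -w.a) = (s.map ArchWeight.a).map Neg.neg := fun s => by
    rw [Multiset.map_map]; rfl
  rw [hW, InfinityType.hodgeTateWeights, hneg, hTa]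
  simp only [Multiset.map_singleton, neg_neg]

/-- ★★★ **The R3⁺-repaired reciprocity conjunct for `n = 1` holds over EVERY number field `K`**, for
every reciprocity datum `𝓡` and every compactness witness — unconditionally (no named fact as a
hypothesis): `SoloInformedGLOneSerreDischarged` reduced it to HT₁, proved above.
[cite: BuzzardGeeLMS2014, Conj. 3.2.1–3.2.2, Rem. 3.2.3 and Rem. 3.2.5] [cite: Patrikis2019, Prop. 2.2.1]
[cite: SerreAbelianLadic1968, Ch. III §1.1, §2.3 and App. A.5] -/
theorem globalLanglandsCorrespondenceGLnR3plus_one (𝓡 : ReciprocityData K) :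
    R3plus.GlobalLanglandsCorrespondenceGLnR3plus 1 K 𝓡 hcpt :=
  globalLanglandsCorrespondenceGLnR3plus_one_of_ht 𝓡 fun π _θ hχ _p _q hinf _T _e hmod _ℓ _ ι _v hv =>
    hodgeTateCompatibleAt_weilRep 𝓡 ι π.1 hχ hinf hmod hv

/-- ★★★ **Hence also the automorphic-to-Galois half (A⁺)₁ and every clause it carries**, over every `K`.
[cite: BuzzardGeeLMS2014, Conj. 3.2.1–3.2.2] -/
theorem automorphicToGaloisR3plus_one (𝓡 : ReciprocityData K) :
    R3plus.AutomorphicToGaloisR3plus 1 𝓡 hcpt :=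
  (globalLanglandsCorrespondenceGLnR3plus_one_iff_automorphicToGaloisR3plus 𝓡).mp
    (globalLanglandsCorrespondenceGLnR3plus_one 𝓡)

end LocalWeights

end GLOneRigidity

end Summit.Langlands.Langlands.Theorems

end
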